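/-
Copyright (c) 2026 the pub-hodgecm-mathlib formalisation cell (harness21).  Prover seat hodgecm-mathlib-F0P3a-p01 (g37), FLOOR 0, SUPPORTS-ONLY on h413; dealer∕pen
LH4-plan (g13) WORD #117 (T2) «THE TRUNK» under LH4-p05 (g8)'s B2b-3 ARCHITECTURE OF RECORD 13:57:18Z ∕ β-BOARD v1 R10.  2026-09-04.
-/
import Summits.HodgeConjecture.HodgeConjecture.Theorems.F0P3cDyRamOddLabelledBoxSumDefs          -- (T1) DEFS leaf (this seat): `OddLabelledBoxSum`, `IsRestShape`, `restTarget`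
import Summits.HodgeConjecture.HodgeConjecture.Theorems.F0P3cDyRamLabelledOddStageBBoxForm       -- ★ p860646 (LH4-p05 (g8)): `dyadicFence_cleanSgnFrameConstLawAt_derived_ofRecord_of_box (hbox)`; brings ★ p860518, ★ p860462, DEFS
import Summits.HodgeConjecture.HodgeConjecture.Theorems.F0P3cDyRamLabelledOddPureStrataT         -- ★ p860780∕p860805 (LH4-p11 (g8)): T₁∕T₂ columns
import Summits.HodgeConjecture.HodgeConjecture.Theorems.F0P3cDyRamLabelledOddPureStrataT3        -- ★ p860897 (LH4-p11 (g8)): T₃ column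
import Summits.HodgeConjecture.HodgeConjecture.Theorems.F0P3cDyRamLabelledOddPureStrataG1        -- ★ p860827 (LH4-p11 (g8)): G₁ one-slot cell column
import Summits.HodgeConjecture.HodgeConjecture.Theorems.F0P3cDyRamLabelledOddPureStrataG2        -- ★ p860856 (LH4-p11 (g8)): G₂ one-slot cell column
import Summits.HodgeConjecture.HodgeConjecture.Theorems.F0P3cDyRamLabelledOddCoreCell            -- ★-pending p861235 (this seat): R1 core cell
import Summits.HodgeConjecture.HodgeConjecture.Theorems.F0P3cDyRamTowerSignToken                 -- ★ p860771∕p860907 (LH4-p05 (g8)): the tower-sign tokens e_A, e_B, e_C exist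
import Summits.HodgeConjecture.HodgeConjecture.Theorems.F0P3cDyRamElementDatumParity             -- ★ (LH4-p10 (g2)): `isoceles_of_isElementDatum`, `depth_mod_two_eq_of_isElementDatum`
import Summits.HodgeConjecture.HodgeConjecture.Theorems.F0P3cDyRamDiagonalKappaCoreHangingClass  -- ★: `two_le_d_of_v_two_lt_one`
import HarnessLib

/-!
# Crux `H413`, LH4 «(D-RAM) FOUR-FRAME» road, STAGE 1b (β) — (T2) THE TRUNK: `hbox` of ★ p860646 FROM the arithmetic Prop (T1) `OddLabelledBoxSum`, the ★ columns, and the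
# pending rows of β-BOARD v1 as hypotheses — **SKELETON v1 (against the (T1) v1 rest-sum cut 171b84f09a96242a)**

Cell `hodgecm-mathlib` (D-0151), FLOOR 0, crux item H413 = `stmt-HodgeConjecture-24833`, route `HCCMUnconditional`; squad F0∕P3c∕LH4.  THEOREMS ONLY (no `def`, no instance, no
notation, no `sorry`, default heartbeats); lane `--supports stmt-HodgeConjecture-24833 --as helper` (count-neutral; pays NO row; the pay line is the assembler's ONE bare head
`cleanSgn_ofRecord` in a later file, dealer WORD #122 pen condition).

THE TRUNK.  For every datum of `hbox` (★ p860646 `table_of_box`'s binder block: complete `K` with finite residue field, `|2| < 1`, ramified datum `(σ, ϖ, d, t)`, a non-norm unit `u`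
with the dichotomy, an element datum `(α, β; n₁, n₂, n₃)` above `n0DerivedOfRecord d`, `T = diag(α, β, 1)`, slot `i`) the box sum of the per-stratum clean-shell labelled-odd tables
vanishes — by (T1) `OddLabelledBoxSum` applied at `q := #𝓀`, the depths, the slot, the four sign letters `ωX := normSign σ e_X` (tokens from ★ p860771∕p860907) and `ωm := normSign σ (−1)`,
and `v a :=` the board's COMMON SHAPE at axis `a`, with its binders discharged: `hcore` ← ★-pending p861235 R1; `hT1 hT2 hT3` ← ★ p860780∕p860897; `hG1 hG2` ← ★ p860827∕p860856;
`hzero` ← ★ `finsum_stratum_sep_eq_zero_of_not_shape`; `hd hiso hreg h1 h2 h3` ← ★ `two_le_d_of_v_two_lt_one`, ★ `isoceles_of_isElementDatum`, ★ №6 `mcOfRecord_le_n0DerivedOfRecord`,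
★ `depth_mod_two_eq_of_isElementDatum`; and the PENDING rows carried as hypotheses in their lattice currency (∀-closed, token binders as in ★ p860827): `hP3G1 ∕ hP3G2` (β-BOARD R3∕R4:
the capped tube classes BEYOND the one-slot cell), `hP2G3` (R2+R5: all capped tube classes of tower 3), `hRest` (R6+R7+R8 SUMMED: the rest shapes total `restTarget`).  When those heads
land, the final file `…OddLabelledTableOfRecord.lean` discharges them by name and exposes the bare head `cleanSgn_ofRecord : type_of% @…FourFrame.stub_law_cleanSgn`.
HONEST LABEL.  Count-neutral trunk; (T3) `oddLabelledBoxSum : OddLabelledBoxSum` (LH4-p08 (g9) + LH4-p10 (g6)), R2–R8 and therefore `hbox`, the table, (β-BAL), (β), T₊ are OPEN;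
`HC_CM` is proved only modulo the 7 printed citations (2 remaining named inputs: hLiu418 = `stmt-HodgeConjecture-24832`, h413 = `stmt-HodgeConjecture-24833`) until rung 0 closes.

## References
* [Kottwitz1986BaseChangeUnits] R. E. Kottwitz, *Base change for unit elements of Hecke algebras*, Compositio Math. 60 (1986), §1 pp. 240–241.
* [Rogawski1990] J. D. Rogawski, *Automorphic Representations of Unitary Groups in Three Variables*, Ann. of Math. Stud. 123 (1990), §4.9 Prop. 4.9.1 (a)(b) p. 55; §4.10 p. 58.
* [LanglandsShelstad1987] R. P. Langlands, D. Shelstad, *On the definition of transfer factors*, Math. Ann. 278 (1987), §1.3, §3.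
-/

set_option autoImplicit false

noncomputable section

namespace Summit.HodgeConjecture.HodgeConjecture.Cruxes.H413.F0P3cDyRamLabelledOddStageBTable

open Literature.NumberTheory.Automorphic Literature.NumberTheory.Automorphic.HermitianLattice Literature.NumberTheory.Automorphic.UnitaryGroup
open Literature.NumberTheory.Automorphic.UnitaryLatticeTree Literature.NumberTheory.Automorphic.UnitaryThreeFourFrame
open Summit.HodgeConjecture.HodgeConjecture.Cruxes.H413.F0P3cDyRamFourFramePieces
open Summit.HodgeConjecture.HodgeConjecture.Cruxes.H413.F0P3cDyRamFourFrameCensusDefs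
open Summit.HodgeConjecture.HodgeConjecture.Cruxes.H413.F0P3cDyRamStageOneBDefs
open Summit.HodgeConjecture.HodgeConjecture.Cruxes.H413.F0P3cDyRamStageOneBDerivedDefs
open Summit.HodgeConjecture.HodgeConjecture.Cruxes.H413.F0P3cDyRamDiagonalTorusDefs
open Summit.HodgeConjecture.HodgeConjecture.Cruxes.H413.F0P3cDyRamDiagonalStrataDefs
open Summit.HodgeConjecture.HodgeConjecture.Cruxes.H413.F0P3cDyRamLabelledOddCountDefs
open Summit.HodgeConjecture.HodgeConjecture.Cruxes.H413.F0P3cDyRamLabelledKappaStrataPartition (finsum_stratum_sep_eq_zero_of_not_shape)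
open Summit.HodgeConjecture.HodgeConjecture.Cruxes.H413.F0P3cDyRamOddLabelledBoxSumDefs
open Summit.HodgeConjecture.HodgeConjecture.Cruxes.H413.F0P3cDyRamLabelledOddPureStrataT
open Summit.HodgeConjecture.HodgeConjecture.Cruxes.H413.F0P3cDyRamLabelledOddPureStrataT3
open Summit.HodgeConjecture.HodgeConjecture.Cruxes.H413.F0P3cDyRamLabelledOddPureStrataG1
open Summit.HodgeConjecture.HodgeConjecture.Cruxes.H413.F0P3cDyRamLabelledOddPureStrataG2
open Summit.HodgeConjecture.HodgeConjecture.Cruxes.H413.F0P3cDyRamLabelledOddCoreCell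
open Summit.HodgeConjecture.HodgeConjecture.Cruxes.H413.F0P3cDyRamTowerSignToken
open Summit.HodgeConjecture.HodgeConjecture.Cruxes.H413.F0P3cDyRamElementDatumParity
open Summit.HodgeConjecture.HodgeConjecture.Cruxes.H413.F0P3cDyRamDiagonalKappaCoreHangingClass (two_le_d_of_v_two_lt_one)
open scoped Matrix MatrixGroups WithZero Valued

/-! ## §1  Small arithmetic of the schedules of record -/

/-- `3d − 2 + d % 2 ≤ mcOfRecord d` (in fact equality). [cite: Rogawski1990, §4.9 Prop. 4.9.1 (a) p. 55] -/
theorem three_mul_sub_two_add_mod_le_mcOfRecord (d : ℕ) : 3 * d - 2 + d % 2 ≤ mcOfRecord d := by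
  show 3 * d - 2 + d % 2 ≤ 2 * ((d % 2 + 2 * d - 1 + d) / 2)
  omega

/-- `3d − 2 + d % 2 ≤ n0DerivedOfRecord d`. [cite: Rogawski1990, §4.9 Prop. 4.9.1 (a) p. 55] -/
theorem three_mul_sub_two_add_mod_le_n0DerivedOfRecord (d : ℕ) : 3 * d - 2 + d % 2 ≤ n0DerivedOfRecord d :=
  (three_mul_sub_two_add_mod_le_mcOfRecord d).trans (mcOfRecord_le_n0DerivedOfRecord d)

/-- `d % 2 + 1 ≤ n0DerivedOfRecord d` for `2 ≤ d` (the R1 core-cell threshold). [cite: Rogawski1990, §4.9 Prop. 4.9.1 (a) p. 55] -/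
theorem mod_two_add_one_le_n0DerivedOfRecord {d : ℕ} (hd : 2 ≤ d) : d % 2 + 1 ≤ n0DerivedOfRecord d :=
  le_trans (by omega) (three_mul_sub_two_add_mod_le_n0DerivedOfRecord d)

/-! ## §2  The trunk -/

/-- **(T2) THE TRUNK — `hbox` OF ★ p860646 FROM (T1) `OddLabelledBoxSum` + THE ★ COLUMNS + THE PENDING ROWS OF β-BOARD v1.**  Hypotheses: `h` = (T1); `hP3G1 ∕ hP3G2` = the
capped tube classes of towers 1∕2 BEYOND the one-slot cell (R3∕R4, PROPOSED closed form ODDBOX-ORACLE §1: per-slot boundary factor); `hP2G3` = all capped tube classes of tower 3 (R2+R5);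
`hRest` = the rest shapes total `restTarget` (R6+R7+R8).  Conclusion: `hbox` VERBATIM (★ `…StageBBoxForm.table_of_box` ∕ `…_of_box` binder).
[cite: Kottwitz1986BaseChangeUnits, §1 pp. 240–241] [cite: Rogawski1990, §4.9 Prop. 4.9.1 (a)(b) p. 55] [cite: LanglandsShelstad1987, §1.3, §3] -/
theorem hbox_of_oddBoxSum (h : OddLabelledBoxSum)
    (hP3G1 : (∀ {K : Type} [Field K] [Valued K ℤᵐ⁰] [CompleteSpace K] [Fintype 𝓀[K]] (σ : K →+* K) (ϖ : K) (d t : ℕ),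
      Valued.v (2 : K) < 1 → IsRamifiedQuadraticDatum σ ϖ d t →
      ∀ (α β : K) (n₁ n₂ n₃ : ℕ), IsElementDatum σ ϖ (n0DerivedOfRecord d) α β n₁ n₂ n₃ →
      ∀ (T : GL (Fin 3) K), (T : Matrix (Fin 3) (Fin 3) K) = Matrix.diagonal ![α, β, 1] →
      ∀ (ρ s : ℕ), 1 ≤ ρ → n₂ < 2 * ρ + mstarOfRecord d → 2 * ρ + s + d % 2 = n₁ → 2 ∣ s → 2 * ρ + 2 + d % 2 ≤ min n₂ n₃ →
      ∀ {eB : K}, σ eB = eB → Valued.v eB = 1 → Valued.v ((ϖ ^ mstarOfRecord d)⁻¹ * ((β - 1) * ((ϖ * σ ϖ) ^ ((n₁ - d % 2) / 2))⁻¹ - eB * ((ϖ - σ ϖ) * ((ϖ * σ ϖ) ^ ((d - d % 2) / 2))⁻¹))) ≤ 1 →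
      ∀ i : Fin 3,
        ∑ᶠ M ∈ {M : Submodule 𝒪[K] (Fin 3 → K) | M ∈ stratum σ ϖ T ![2 * ρ, 2 * ρ + s, 2 * ρ + s] ∧
            (LatticeInLevel ϖ (d % 2) (Matrix.diagonal ![α - 1, β - 1, 0]) M ∧ ¬ LatticeInLevel ϖ (d % 2 + 1) (Matrix.diagonal ![α - 1, β - 1, 0]) M ∧
              LatticeInLevel ϖ (mcOfRecord d) (Matrix.diagonal ![(α - 1) * (α - 1), (β - 1) * (β - 1), 0]) M)},
          (labelledOddCount σ ϖ 0 i (valueClassLabel σ ϖ (α - 1) (β - 1) (mstarOfRecord d) d) M : ℚ) /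
            ((((unitStabilizer M).map (unitNormMap σ 3)).relIndex (fixedUnitTorus σ 3) : ℕ) : ℚ) =
          (normSign σ eB : ℚ) / 2 * (Fintype.card 𝓀[K] : ℚ) ^ (2 * ρ + s / 2 - 1) *
            (![(0 : ℚ), ((if 2 * d + d % 2 + 2 * ρ ≤ n₂ then (Fintype.card 𝓀[K] : ℚ) - 1 else 0) - (if n₂ + 2 = 2 * d + d % 2 + 2 * ρ then 1 else 0)), (normSign σ (-1 : K) : ℚ) * ((if 2 * d + d % 2 + 2 * ρ ≤ n₃ then (Fintype.card 𝓀[K] : ℚ) - 1 else 0) - (if n₃ + 2 = 2 * d + d % 2 + 2 * ρ then 1 else 0))] : Fin 3 → ℚ) i))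
    (hP3G2 : (∀ {K : Type} [Field K] [Valued K ℤᵐ⁰] [CompleteSpace K] [Fintype 𝓀[K]] (σ : K →+* K) (ϖ : K) (d t : ℕ),
      Valued.v (2 : K) < 1 → IsRamifiedQuadraticDatum σ ϖ d t →
      ∀ (α β : K) (n₁ n₂ n₃ : ℕ), IsElementDatum σ ϖ (n0DerivedOfRecord d) α β n₁ n₂ n₃ →
      ∀ (T : GL (Fin 3) K), (T : Matrix (Fin 3) (Fin 3) K) = Matrix.diagonal ![α, β, 1] →
      ∀ (ρ s : ℕ), 1 ≤ ρ → n₁ < 2 * ρ + mstarOfRecord d → 2 * ρ + s + d % 2 = n₂ → 2 ∣ s → 2 * ρ + 2 + d % 2 ≤ min n₁ n₃ →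
      ∀ {eA : K}, σ eA = eA → Valued.v eA = 1 → Valued.v ((ϖ ^ mstarOfRecord d)⁻¹ * ((α - 1) * ((ϖ * σ ϖ) ^ ((n₂ - d % 2) / 2))⁻¹ - eA * ((ϖ - σ ϖ) * ((ϖ * σ ϖ) ^ ((d - d % 2) / 2))⁻¹))) ≤ 1 →
      ∀ i : Fin 3,
        ∑ᶠ M ∈ {M : Submodule 𝒪[K] (Fin 3 → K) | M ∈ stratum σ ϖ T ![2 * ρ + s, 2 * ρ, 2 * ρ + s] ∧
            (LatticeInLevel ϖ (d % 2) (Matrix.diagonal ![α - 1, β - 1, 0]) M ∧ ¬ LatticeInLevel ϖ (d % 2 + 1) (Matrix.diagonal ![α - 1, β - 1, 0]) M ∧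
              LatticeInLevel ϖ (mcOfRecord d) (Matrix.diagonal ![(α - 1) * (α - 1), (β - 1) * (β - 1), 0]) M)},
          (labelledOddCount σ ϖ 0 i (valueClassLabel σ ϖ (α - 1) (β - 1) (mstarOfRecord d) d) M : ℚ) /
            ((((unitStabilizer M).map (unitNormMap σ 3)).relIndex (fixedUnitTorus σ 3) : ℕ) : ℚ) =
          (normSign σ eA : ℚ) / 2 * (Fintype.card 𝓀[K] : ℚ) ^ (2 * ρ + s / 2 - 1) *
            (![((if 2 * d + d % 2 + 2 * ρ ≤ n₁ then (Fintype.card 𝓀[K] : ℚ) - 1 else 0) - (if n₁ + 2 = 2 * d + d % 2 + 2 * ρ then 1 else 0)), (0 : ℚ), (normSign σ (-1 : K) : ℚ) * ((if 2 * d + d % 2 + 2 * ρ ≤ n₃ then (Fintype.card 𝓀[K] : ℚ) - 1 else 0) - (if n₃ + 2 = 2 * d + d % 2 + 2 * ρ then 1 else 0))] : Fin 3 → ℚ) i))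
    (hP2G3 : (∀ {K : Type} [Field K] [Valued K ℤᵐ⁰] [CompleteSpace K] [Fintype 𝓀[K]] (σ : K →+* K) (ϖ : K) (d t : ℕ),
      Valued.v (2 : K) < 1 → IsRamifiedQuadraticDatum σ ϖ d t →
      ∀ (α β : K) (n₁ n₂ n₃ : ℕ), IsElementDatum σ ϖ (n0DerivedOfRecord d) α β n₁ n₂ n₃ →
      ∀ (T : GL (Fin 3) K), (T : Matrix (Fin 3) (Fin 3) K) = Matrix.diagonal ![α, β, 1] →
      ∀ (ρ s : ℕ), 1 ≤ ρ → 2 * ρ + s + d % 2 = n₃ → 2 ∣ s → 2 * ρ + 2 + d % 2 ≤ min n₁ n₂ →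
      ∀ {eC : K}, σ eC = eC → Valued.v eC = 1 → Valued.v ((ϖ ^ mstarOfRecord d)⁻¹ * ((β - α) * ((ϖ * σ ϖ) ^ ((n₃ - d % 2) / 2))⁻¹ - eC * ((ϖ - σ ϖ) * ((ϖ * σ ϖ) ^ ((d - d % 2) / 2))⁻¹))) ≤ 1 →
      ∀ i : Fin 3,
        ∑ᶠ M ∈ {M : Submodule 𝒪[K] (Fin 3 → K) | M ∈ stratum σ ϖ T ![2 * ρ + s, 2 * ρ + s, 2 * ρ] ∧
            (LatticeInLevel ϖ (d % 2) (Matrix.diagonal ![α - 1, β - 1, 0]) M ∧ ¬ LatticeInLevel ϖ (d % 2 + 1) (Matrix.diagonal ![α - 1, β - 1, 0]) M ∧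
              LatticeInLevel ϖ (mcOfRecord d) (Matrix.diagonal ![(α - 1) * (α - 1), (β - 1) * (β - 1), 0]) M)},
          (labelledOddCount σ ϖ 0 i (valueClassLabel σ ϖ (α - 1) (β - 1) (mstarOfRecord d) d) M : ℚ) /
            ((((unitStabilizer M).map (unitNormMap σ 3)).relIndex (fixedUnitTorus σ 3) : ℕ) : ℚ) =
          (normSign σ eC : ℚ) / 2 * (Fintype.card 𝓀[K] : ℚ) ^ (2 * ρ + s / 2 - 1) *
            (![(normSign σ (-1 : K) : ℚ) * ((if 2 * d + d % 2 + 2 * ρ ≤ n₁ then (Fintype.card 𝓀[K] : ℚ) - 1 else 0) - (if n₁ + 2 = 2 * d + d % 2 + 2 * ρ then 1 else 0)), ((if 2 * d + d % 2 + 2 * ρ ≤ n₂ then (Fintype.card 𝓀[K] : ℚ) - 1 else 0) - (if n₂ + 2 = 2 * d + d % 2 + 2 * ρ then 1 else 0)), (0 : ℚ)] : Fin 3 → ℚ) i))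
    (hRest : (∀ {K : Type} [Field K] [Valued K ℤᵐ⁰] [CompleteSpace K] [Fintype 𝓀[K]] (σ : K →+* K) (ϖ : K) (d t : ℕ),
      Valued.v (2 : K) < 1 → IsRamifiedQuadraticDatum σ ϖ d t →
      ∀ (α β : K) (n₁ n₂ n₃ : ℕ), IsElementDatum σ ϖ (n0DerivedOfRecord d) α β n₁ n₂ n₃ →
      ∀ (T : GL (Fin 3) K), (T : Matrix (Fin 3) (Fin 3) K) = Matrix.diagonal ![α, β, 1] →
      ∀ {eA eB eC : K}, σ eA = eA → Valued.v eA = 1 → Valued.v ((ϖ ^ mstarOfRecord d)⁻¹ * ((α - 1) * ((ϖ * σ ϖ) ^ ((n₂ - d % 2) / 2))⁻¹ - eA * ((ϖ - σ ϖ) * ((ϖ * σ ϖ) ^ ((d - d % 2) / 2))⁻¹))) ≤ 1 →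
        σ eB = eB → Valued.v eB = 1 → Valued.v ((ϖ ^ mstarOfRecord d)⁻¹ * ((β - 1) * ((ϖ * σ ϖ) ^ ((n₁ - d % 2) / 2))⁻¹ - eB * ((ϖ - σ ϖ) * ((ϖ * σ ϖ) ^ ((d - d % 2) / 2))⁻¹))) ≤ 1 →
        σ eC = eC → Valued.v eC = 1 → Valued.v ((ϖ ^ mstarOfRecord d)⁻¹ * ((β - α) * ((ϖ * σ ϖ) ^ ((n₃ - d % 2) / 2))⁻¹ - eC * ((ϖ - σ ϖ) * ((ϖ * σ ϖ) ^ ((d - d % 2) / 2))⁻¹))) ≤ 1 →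
      ∀ i : Fin 3,
        (∑ a : Fin 3 → Fin (n₁ + n₂ + n₃ + 1),
          (if IsRestShape d n₁ n₂ n₃ (fun j => (a j : ℕ)) then
            ∑ᶠ M ∈ {M : Submodule 𝒪[K] (Fin 3 → K) | M ∈ stratum σ ϖ T (fun j => (a j : ℕ)) ∧
            (LatticeInLevel ϖ (d % 2) (Matrix.diagonal ![α - 1, β - 1, 0]) M ∧ ¬ LatticeInLevel ϖ (d % 2 + 1) (Matrix.diagonal ![α - 1, β - 1, 0]) M ∧
              LatticeInLevel ϖ (mcOfRecord d) (Matrix.diagonal ![(α - 1) * (α - 1), (β - 1) * (β - 1), 0]) M)},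
          (labelledOddCount σ ϖ 0 i (valueClassLabel σ ϖ (α - 1) (β - 1) (mstarOfRecord d) d) M : ℚ) /
            ((((unitStabilizer M).map (unitNormMap σ 3)).relIndex (fixedUnitTorus σ 3) : ℕ) : ℚ)
           else 0)) =
          restTarget (Fintype.card 𝓀[K]) d n₁ n₂ n₃ (normSign σ eA) (normSign σ eB) (normSign σ eC) (normSign σ (-1 : K)) i)) :
    ∀ {K : Type} [Field K] [Valued K ℤᵐ⁰] [CompleteSpace K] [Fintype 𝓀[K]] (σ : K →+* K) (ϖ : K) (d t : ℕ),
      Valued.v (2 : K) < 1 → IsRamifiedQuadraticDatum σ ϖ d t →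
      ∀ (u : K), σ u = u → Valued.v u = 1 → (¬ ∃ z : K, z * σ z = u) →
        (∀ x : K, σ x = x → x ≠ 0 → (∃ z : K, z * σ z = x) ∨ ∃ z : K, z * σ z = u * x) →
      ∀ (α β : K) (n₁ n₂ n₃ : ℕ), IsElementDatum σ ϖ (n0DerivedOfRecord d) α β n₁ n₂ n₃ →
      ∀ (T : GL (Fin 3) K), (T : Matrix (Fin 3) (Fin 3) K) = Matrix.diagonal ![α, β, 1] →
      ∀ i : Fin 3,
        (∑ a : Fin 3 → Fin (n₁ + n₂ + n₃ + 1), ∑ᶠ M ∈ {M : Submodule 𝒪[K] (Fin 3 → K) | M ∈ stratum σ ϖ T (fun j => (a j : ℕ)) ∧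
            (LatticeInLevel ϖ (d % 2) (Matrix.diagonal ![α - 1, β - 1, 0]) M ∧ ¬ LatticeInLevel ϖ (d % 2 + 1) (Matrix.diagonal ![α - 1, β - 1, 0]) M ∧
              LatticeInLevel ϖ (mcOfRecord d) (Matrix.diagonal ![(α - 1) * (α - 1), (β - 1) * (β - 1), 0]) M)},
          (labelledOddCount σ ϖ 0 i (valueClassLabel σ ϖ (α - 1) (β - 1) (mstarOfRecord d) d) M : ℚ) /
            ((((unitStabilizer M).map (unitNormMap σ 3)).relIndex (fixedUnitTorus σ 3) : ℕ) : ℚ)) = 0 := by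
  intro K _ _ _ _ σ ϖ d t h2 hD u _hσu _hvu _hun _hdich α β n₁ n₂ n₃ hE T hT i
  classical
  -- letters of the datum
  have hd2 : 2 ≤ d := two_le_d_of_v_two_lt_one hD h2
  have hmc : mcOfRecord d ≤ n0DerivedOfRecord d := mcOfRecord_le_n0DerivedOfRecord d
  have hreg0 := three_mul_sub_two_add_mod_le_n0DerivedOfRecord d
  have hdN₀ : d ≤ n0DerivedOfRecord d := le_trans (by omega) hreg0
  have hN₀1 : d % 2 + 1 ≤ n0DerivedOfRecord d := mod_two_add_one_le_n0DerivedOfRecord hd2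
  have hn₁ : n0DerivedOfRecord d ≤ n₁ := hE.2.2.2.2.2.2.2.2.1
  have hn₂ : n0DerivedOfRecord d ≤ n₂ := hE.2.2.2.2.2.2.2.2.2.1
  have hn₃ : n0DerivedOfRecord d ≤ n₃ := hE.2.2.2.2.2.2.2.2.2.2
  have hiso := isoceles_of_isElementDatum hD hE
  obtain ⟨hp1, hp2, hp3⟩ := depth_mod_two_eq_of_isElementDatum hD hE hdN₀
  have hvα : Valued.v (α - 1) = Valued.v ϖ ^ n₂ := hE.2.2.2.2.2.2.1
  have hvβ : Valued.v (β - 1) = Valued.v ϖ ^ n₁ := hE.2.2.2.2.2.1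
  have hvβα : Valued.v (β - α) = Valued.v ϖ ^ n₃ := by rw [← neg_sub, Valuation.map_neg]; exact hE.2.2.2.2.2.2.2.1
  -- the three tower-sign tokens (★ p860771∕p860907)
  obtain ⟨eA, hσeA, heA1, heA⟩ := exists_towerSign_of_mcOfRecord_le hD hE.1 hvα hp2 (hmc.trans hn₂)
  obtain ⟨eB, hσeB, heB1, heB⟩ := exists_towerSign_of_mcOfRecord_le hD hE.2.1 hvβ hp1 (hmc.trans hn₁)
  obtain ⟨eC, hσeC, heC1, heC⟩ := exists_towerSign_sub_of_mcOfRecord_le hD hE.1 hE.2.1 hvα hvβα hp3 (hmc.trans hn₃) (hmc.trans hn₂)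
  -- (T1) at the letters of the datum
  exact h (Fintype.card 𝓀[K]) hd2 hiso ⟨hreg0.trans hn₁, hreg0.trans hn₂, hreg0.trans hn₃⟩ hp1 hp2 hp3 i
    (normSign σ eA) (normSign σ eB) (normSign σ eC) (normSign σ (-1 : K))
    (fun a => ∑ᶠ M ∈ {M : Submodule 𝒪[K] (Fin 3 → K) | M ∈ stratum σ ϖ T a ∧
            (LatticeInLevel ϖ (d % 2) (Matrix.diagonal ![α - 1, β - 1, 0]) M ∧ ¬ LatticeInLevel ϖ (d % 2 + 1) (Matrix.diagonal ![α - 1, β - 1, 0]) M ∧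
              LatticeInLevel ϖ (mcOfRecord d) (Matrix.diagonal ![(α - 1) * (α - 1), (β - 1) * (β - 1), 0]) M)},
          (labelledOddCount σ ϖ 0 i (valueClassLabel σ ϖ (α - 1) (β - 1) (mstarOfRecord d) d) M : ℚ) /
            ((((unitStabilizer M).map (unitNormMap σ 3)).relIndex (fixedUnitTorus σ 3) : ℕ) : ℚ))
    (finsum_stratum_core_shell_labelledOdd_div_relIndex_eq_zero hD hE hN₀1 T _ i _)
    (fun s hs => finsum_stratum_T1_shell_labelledOdd_div_relIndex_eq hD hd2 hE hmc T hT s hs hσeB heB1 heB i)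
    (fun s hs => finsum_stratum_T2_shell_labelledOdd_div_relIndex_eq hD hd2 hE hmc T hT s hs hσeA heA1 heA i)
    (fun s hs => finsum_stratum_T3_shell_labelledOdd_div_relIndex_eq hD hd2 hE hmc T hT s hs hσeC heC1 heC i)
    (fun ρ s hρ hs hcell => finsum_stratum_G1_shell_labelledOdd_div_relIndex_eq hD h2 hd2 hE hdN₀ hmc T hT ρ s hρ hs hcell hσeB heB1 heB i)
    (fun ρ s hρ hs hcell => finsum_stratum_G2_shell_labelledOdd_div_relIndex_eq hD h2 hd2 hE hdN₀ hmc T hT ρ s hρ hs hcell hσeA heA1 heA i)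
    (fun ρ s hρ hbey hread hpar hcap => hP3G1 σ ϖ d t h2 hD α β n₁ n₂ n₃ hE T hT ρ s hρ hbey hread hpar hcap hσeB heB1 heB i)
    (fun ρ s hρ hbey hread hpar hcap => hP3G2 σ ϖ d t h2 hD α β n₁ n₂ n₃ hE T hT ρ s hρ hbey hread hpar hcap hσeA heA1 heA i)
    (fun ρ s hρ hread hpar hcap => hP2G3 σ ϖ d t h2 hD α β n₁ n₂ n₃ hE T hT ρ s hρ hread hpar hcap hσeC heC1 heC i)
    (hRest σ ϖ d t h2 hD α β n₁ n₂ n₃ hE T hT hσeA heA1 heA hσeB heB1 heB hσeC heC1 heC i)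
    (fun a ha => finsum_stratum_sep_eq_zero_of_not_shape hD T _ _ a ha)

end Summit.HodgeConjecture.HodgeConjecture.Cruxes.H413.F0P3cDyRamLabelledOddStageBTable

end
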